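import Summits.BirchSwinnertonDyer.BirchSwinnertonDyer.Theorems.KolyvaginDepthDoorDepthTableSteinWuthrichTwistTolerance
import Summits.BirchSwinnertonDyer.BirchSwinnertonDyer.Theorems.KolyvaginDepthDoorSurjectiveModPQuadraticTwist
import Literature.NumberTheory.EllipticCurves.QuadraticTwistProofs
import Literature.NumberTheory.EllipticCurves.PAdicGrossZagierConstantTermProofs
import Literature.NumberTheory.EllipticCurves.LFunctionPrimeCoeff
import Literature.NumberTheory.DiophantineGeometry.LocalReductionProofs
import HarnessLib

/-!
# Route `KolyvaginDepthDoor`, crux `KolyvaginDepthSupplyKN` (stmt-BirchSwinnertonDyer-22820) —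
# DEPTH TABLE v15, GENERIC: the even-rank row mechanism with `E`-SIDED hypotheses (the twist's surjectivity, good reduction and
# ordinarity at `p` DERIVED from the curve's)

Helper file of the lead prover of line `levelone` (kdd-p1 g19; `--supports stmt-BirchSwinnertonDyer-22820
--as helper`); it closes nothing and BSD is NOT proved by it.

`cruxBody_of_twistBSDQuotient_le_of_steinWuthrich_bcs` (`…TwistTolerance`) asks, on the twist model `T` of `E^{(d_K)}`, three arithmetic
side conditions at `p`: `ρ̄_{T,p}` onto, good reduction, ordinarity. For `d_K` SQUARE-FREE (every odd fundamental discriminant) all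
three follow from the SAME conditions on `E`, by three tree theorems: surjectivity is twist-invariant
(`hasSurjectiveModNGaloisRep_of_smul_eq_quadraticTwist`, g19), good reduction at `p ∤ 2 d_K` is twist-invariant
(`hasGoodReductionAt_quadraticTwist`, `hasGoodReductionAt_smul_iff_holds`), and the PROVED twisting formula `a_p(T) = (d_K/p)·a_p(E)`
(`frobeniusTrace_quadraticTwist_holds`, Knapp Prop. 12.10) carries ordinarity. Hence:

* `cruxBody_of_twistBSDQuotient_le_of_steinWuthrich_bcs_ESided` — `W` in the Stein–Wuthrich range on W. Zhang's ♠ cell at an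
  admissible Kodaira–Néron prime `p`; `K` Heegner with `d_K` square-free, `∉ {−3,−4}`, `p ∤ d_K`; `T` ANY globally minimal model of
  `E^{(d_K)}` (`C • T = W.quadraticTwist d_K`) with Kodaira–Néron at `p`; THEN «`ord_{s=1} L(T,s) = 1` ∧ `ord_p(L'(T,1)/(Ω_T Reg_T)) ≤ k`»
  with `k + 1 ≤ rank W` gives the clause of `KolyvaginDepthSupplyKN` at `W`. The only `T`-side inputs left are the minimal model
  itself, its Kodaira–Néron exponents at `p`, and the two analytic hypotheses — exactly the shape of g18's odd-rank `…LValueUniform`.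

CONDITIONAL on Stein–Wuthrich 2013 Thm. 1.1, W. Zhang 2014 L8.4 (1) / 9.1, Burungale–Castella–Skinner 2025 Cor. 1.3.1, GZK by name;
per `(W, p, K, T)`; nothing class-wide (the open stub (S♭) is untouched); BSD is NOT proved by it.

References: [BurungaleCastellaSkinner2025] Cor. 1.3.1; [Darmon2004] Thm. 3.22; [Knapp1993] Prop. 12.10; [SilvermanAEC2009] VII.5.1,
X.2 Prop. 2.4, X.5 Cor. 5.4; [SteinWuthrich2013] Thm. 1.1; [WZhang2014] L8.4 (1), Thm. 9.1.
-/

set_option linter.dupNamespace false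

noncomputable section

open scoped Classical NumberField

namespace Summit.BirchSwinnertonDyer.BirchSwinnertonDyer.Theorems.KolyvaginDepthDoor

open Literature.NumberTheory.EllipticCurves Literature.NumberTheory.EllipticCurves.ModularForms
  WeierstrassCurve NumberField IsDedekindDomain Rat.HeightOneSpectrum
open Summit.BirchSwinnertonDyer.BirchSwinnertonDyer.Theorems

/-- **Good ORDINARY reduction of a twist model at `p ∤ 2d` from that of the curve** (`d` square-free; `T` globally minimal with
`C • T = W.quadraticTwist d`): good reduction of `E^{(d)}` at `p` (`hasGoodReductionAt_quadraticTwist`) transported along `C`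
(`hasGoodReductionAt_smul_iff_holds`), and `a_p(T) = (d/p)·a_p(W)` (`frobeniusTrace_quadraticTwist_holds`) with `(d/p) = ±1`.
[cite: Knapp1993, Prop. 12.10 (PDF pp. 302–303)] [cite: SilvermanAEC2009, VII.5.1 and X.2 Prop. 2.4] -/
theorem goodOrdinary_of_smul_eq_quadraticTwist (W T : WeierstrassCurve ℚ) [W.IsElliptic] [W.IsGloballyMinimal]
    [T.IsElliptic] [T.IsGloballyMinimal] {d : ℤ} (hd : Squarefree d) {C : VariableChange ℚ}
    (hC : C • T = W.quadraticTwist (d : ℚ)) (p : ℕ) [hp : Fact p.Prime] (hpd : ¬ (p : ℤ) ∣ 2 * d)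
    (hgood : W.HasGoodReductionAtPrime p) (hord : ¬ (p : ℤ) ∣ W.frobeniusTrace p) :
    T.HasGoodReductionAtPrime p ∧ ¬ (p : ℤ) ∣ T.frobeniusTrace p := by
  have hpP : p.Prime := hp.out
  have hΔW : ¬ (p : ℤ) ∣ minimalDiscriminantInt W := W.not_dvd_minimalDiscriminantInt_of_hasGoodReductionAtPrime p hgood
  -- good reduction of `T` at `p`
  obtain ⟨v, hv⟩ : ∃ v : HeightOneSpectrum (𝓞 ℚ), (primesEquiv v : ℕ) = p :=
    ⟨primesEquiv.symm ⟨p, hpP⟩, by rw [Equiv.apply_symm_apply]⟩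
  have hgoodWd : (W.quadraticTwist (d : ℚ)).HasGoodReductionAt v :=
    W.hasGoodReductionAt_quadraticTwist v (by rw [hv]; exact hpd) (by rw [hv]; exact hΔW)
  have hgoodTv : T.HasGoodReductionAt v := by
    rw [← hC] at hgoodWd
    exact (WeierstrassCurve.hasGoodReductionAt_smul_iff_holds v T _).mp hgoodWd
  have hgoodT : T.HasGoodReductionAtPrime p := (hasGoodReductionAtPrime_primesEquiv_iff_holds T v p hv).mpr hgoodTv
  refine ⟨hgoodT, ?_⟩
  -- ordinarity by the twisting formula
  have htw := frobeniusTrace_quadraticTwist_holds W T d hd ⟨C, hC⟩ p hpd hΔW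
  rw [htw]
  have hdp : ((d : ℤ) : ZMod p) ≠ 0 := by
    intro h0
    have : (p : ℤ) ∣ d := (ZMod.intCast_zmod_eq_zero_iff_dvd _ p).mp h0
    exact hpd (dvd_mul_of_dvd_right this 2)
  intro hdvd
  rcases legendreSym.eq_one_or_neg_one p hdp with h1 | h1 <;> rw [h1] at hdvd
  · exact hord (by simpa using hdvd)
  · exact hord (by simpa using hdvd)

/-- **THE EVEN-RANK ROW MECHANISM WITH `E`-SIDED HYPOTHESES (square-free `d_K`, tolerance `k + 1 ≤ rank W`).** `W` globally minimal,
non-CM, `2 ≤ rank`, `N_E ≤ 30 000`; `5 ≤ p < 1000` good ordinary, `ρ_{W,p^n}` onto, Kodaira–Néron, ♠ (1), ♠ (2); `K` imaginary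
quadratic Heegner for `N_E` with `d_K` square-free, `∉ {−3,−4}`, `p ∤ d_K`; `T` any globally minimal model of the twist,
`C • T = W.quadraticTwist d_K`, with Kodaira–Néron at `p`; `ord_{s=1} L(T,s) = 1` and `ord_p(L'(T,1)/(Ω_T·Reg_T)) ≤ k` for some
`k + 1 ≤ rank W`. THEN the clause of `KolyvaginDepthSupplyKN` holds at `W` verbatim: `ρ̄_{T,p}` onto, good reduction and ordinarity
of `T` at `p` are DERIVED from `W` (`hasSurjectiveModNGaloisRep_of_smul_eq_quadraticTwist`, `goodOrdinary_of_smul_eq_quadraticTwist`),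
then `cruxBody_of_twistBSDQuotient_le_of_steinWuthrich_bcs`. CONDITIONAL on Stein–Wuthrich Thm. 1.1, W. Zhang L8.4 (1) / 9.1, BCS 2025
Cor. 1.3.1, GZK by name; per `(W, p, K, T)`; BSD is not proved by it. [cite: SteinWuthrich2013, Thm. 1.1 (p. 1758)]
[cite: WZhang2014, Lemma 8.4 (1) (p. 236), Thm. 9.1 (p. 240)] [cite: BurungaleCastellaSkinner2025, Cor. 1.3.1 (p. 4)]
[cite: Darmon2004, Thm. 3.22] [cite: Knapp1993, Prop. 12.10] -/
theorem cruxBody_of_twistBSDQuotient_le_of_steinWuthrich_bcs_ESided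
    (hSW : SteinWuthrich2013_sha_inf_torsionBy_eq_bot_of_two_le_rank)
    (h84 : Literature.NumberTheory.EllipticCurves.WZhang2014_lemma84_exists_minimal_kolyvaginClass_one_selmerCard)
    (hBCS : BurungaleCastellaSkinner2025.cor131_padicValRat_bsd_rank_le_one)
    (hGZK : rank_eq_analyticRank_of_analyticRank_le_one)
    (W : WeierstrassCurve ℚ) [W.IsElliptic] [W.IsGloballyMinimal] (hcm : ¬ W.HasCM) (hr : 2 ≤ W.mordellWeilRank)
    (hN : W.conductorNorm ℤ ≤ 30000)
    (p : ℕ) [hp : Fact p.Prime] (h5 : 5 ≤ p) (hp1000 : p < 1000) (hgood : W.HasGoodReductionAtPrime p)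
    (hord : ¬ (p : ℤ) ∣ W.frobeniusTrace p)
    (htower : ∀ n : ℕ, W.HasSurjectiveModNGaloisRep (p ^ n : ℕ))
    (hKN : ∀ v : HeightOneSpectrum (𝓞 ℚ), W.HasMultiplicativeReductionAt v →
      ¬ p ∣ W.ordMinimalDiscriminant v)
    (hS1 : ∀ (ℓ : ℕ) [Fact ℓ.Prime], W.HasMultiplicativeReductionAtPrime ℓ →
      ¬ p ∣ padicValInt ℓ W.minimalDiscriminantInt)
    (hS2 : ¬ Squarefree (W.conductorNorm ℤ) →
      (∃ (ℓ : ℕ) (_ : Fact ℓ.Prime), W.HasMultiplicativeReductionAtPrime ℓ ∧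
          ¬ p ∣ padicValInt ℓ W.minimalDiscriminantInt) ∧
        ∃ (ℓ₁ ℓ₂ : ℕ) (_ : Fact ℓ₁.Prime) (_ : Fact ℓ₂.Prime), ℓ₁ ≠ ℓ₂ ∧
          W.HasMultiplicativeReductionAtPrime ℓ₁ ∧ W.HasMultiplicativeReductionAtPrime ℓ₂)
    (K : Type) [Field K] [NumberField K] (hK : IsImaginaryQuadratic K)
    (hD3 : NumberField.discr K ≠ -3) (hD4 : NumberField.discr K ≠ -4) (hsqf : Squarefree (NumberField.discr K))
    (hpD : ¬ ((p : ℤ) ∣ NumberField.discr K))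
    [iNZ : NeZero (W.conductorNorm ℤ)] (hH : SatisfiesHeegnerHypothesis (W.conductorNorm ℤ) K)
    (T : WeierstrassCurve ℚ) [T.IsElliptic] [T.IsGloballyMinimal] (C : WeierstrassCurve.VariableChange ℚ)
    (hC : C • T = W.quadraticTwist (NumberField.discr K : ℚ))
    (hTKN : ∀ v : HeightOneSpectrum (𝓞 ℚ), T.HasMultiplicativeReductionAt v → ¬ p ∣ T.ordMinimalDiscriminant v)
    (hTr : T.analyticRank = 1) (k : ℕ) (hk : k + 1 ≤ W.mordellWeilRank)
    (hval : ∀ q : ℚ, T.leadingLCoeff / ((T.realPeriodRat * T.regulator : ℝ) : ℂ) = (q : ℂ) → padicValRat p q ≤ k) :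
    ∃ (p : ℕ) (hp : Fact p.Prime), 5 ≤ p ∧ W.HasGoodReductionAtPrime p ∧
      ¬ (p : ℤ) ∣ W.frobeniusTrace p ∧ (∀ n : ℕ, W.HasSurjectiveModNGaloisRep (p ^ n : ℕ)) ∧
      (∀ v : HeightOneSpectrum (𝓞 ℚ), W.HasMultiplicativeReductionAt v →
        ¬ p ∣ W.ordMinimalDiscriminant v) ∧
      ∃ (K : Type) (_ : Field K) (_ : NumberField K), IsImaginaryQuadratic K ∧
        NumberField.discr K ≠ -3 ∧ NumberField.discr K ≠ -4 ∧
        ∃ (_ : NeZero (W.conductorNorm ℤ)), SatisfiesHeegnerHypothesis (W.conductorNorm ℤ) K ∧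
        ∃ (Dt : ModularParametrizationData W (W.conductorNorm ℤ)) (β : ℤ) (ι : K →+* ℂ) (n₁ : ℕ)
          (d : KolyvaginHeegnerData Dt β ι n₁), Squarefree n₁ ∧
          (∀ q ∈ n₁.primeFactors, Zhang2014.IsKolyvaginPrime (W.conductorNorm ℤ) W K p q) ∧
          d.kolyvaginClass hp.out 1 ≠ 0 ∧
          (n₁.primeFactors.card + 1 ≤ W.mordellWeilRank ∨
            (n₁.primeFactors.card ≤ W.mordellWeilRank ∧
              n₁.primeFactors.card + 1 ≤ (W.quadraticTwist (NumberField.discr K : ℚ)).mordellWeilRank)) := by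
  have hpP : p.Prime := hp.out
  have hdK : (NumberField.discr K : ℚ) ≠ 0 := by exact_mod_cast NumberField.discr_ne_zero K
  have hsur : W.HasSurjectiveModNGaloisRep p := by simpa only [pow_one] using htower 1
  have hTsur : T.HasSurjectiveModNGaloisRep p :=
    hasSurjectiveModNGaloisRep_of_smul_eq_quadraticTwist W T hdK hC p hsur
  have hp2d : ¬ ((p : ℤ) ∣ 2 * NumberField.discr K) := by
    intro h
    rcases (Nat.prime_iff_prime_int.mp hpP).dvd_or_dvd h with h2 | h2
    · have : p = 2 := (Nat.prime_dvd_prime_iff_eq hpP Nat.prime_two).mp (by exact_mod_cast h2)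
      omega
    · exact hpD h2
  obtain ⟨hTgood, hTord⟩ := goodOrdinary_of_smul_eq_quadraticTwist W T hsqf (by exact_mod_cast hC) p hp2d hgood hord
  exact cruxBody_of_twistBSDQuotient_le_of_steinWuthrich_bcs hSW h84 hBCS hGZK W hcm hr hN p h5 hp1000 hgood hord htower hKN
    hS1 hS2 K hK hD3 hD4 hpD hH T C hC hTgood hTord hTsur hTKN hTr k hk hval

end Summit.BirchSwinnertonDyer.BirchSwinnertonDyer.Theorems.KolyvaginDepthDoor

end
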